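import Mathlib
import Summits.ResolutionOfSingularities.ResolutionOfSingularities.Theorems.RadicialJungCleanModelsPBasisFieldExchange
import Summits.ResolutionOfSingularities.ResolutionOfSingularities.Theorems.RadicialJungCleanModelsPBasisDualDerivations
import Summits.ResolutionOfSingularities.ResolutionOfSingularities.Theorems.RadicialJungCleanModelsPBasisDerivation
import HarnessLib

/-!
# Route `RadicialJung`, crux `CleanModels` (stmt-15917): LEMMA F₀ — height-one purely inseparable intermediate fields of a finitely
# generated extension are finitely generated as vector spaces (PORT of res-B-lens-5 g7's crux workfile `Lens5_AbsDerivation.lean`, part 1)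

Line `Sketch` rev 22 of crux stmt-ResolutionOfSingularities-15917; lead `res-B-lead-1` g3 lands the kernel-checked crux workfile
`Cruxes/DescentPerfectToAll/Lens5_AbsDerivation.lean` (d237cf907357) of seat res-B-lens-5 g7 (AUTHOR of the mathematics and of the Lean
text; the lead only re-homes it under `Theorems/`, namespace `…Theorems.RadicialJung.CleanModels.Lens5.AbsDerivation`).  OURS; nothing here
proves resolution in characteristic `p`.  Content: `p`-independence tools and LEMMA F₀ (`LemmaF0.heightOneIntermediateFinite`): if `F ≤ M` are
subfields of `K` (char `p`), `x^p ∈ F` for all `x ∈ M`, and `M ⊆ F(w)` for a finite `w`, then `M` lies in the `F`-span of finitely many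
elements — the input of LEMMA D-abs (an absolute derivation moving any non-`p`-th power and preserving a finitely generated algebra up to
a denominator), file `…Lens5AbsDerivation.lean`.
-/

noncomputable section

set_option linter.dupNamespace false -- mandated namespace of this single-conjunct summit

open Polynomial
open IsLocalRing
open Literature.RingTheory.PBasis
open Summit.ResolutionOfSingularities.ResolutionOfSingularities.Theorems.RadicialJung.CleanModels

namespace Summit.ResolutionOfSingularities.ResolutionOfSingularities.Theorems.RadicialJung.CleanModels.Lens5.AbsDerivation

section Tools

variable {K : Type} [Field K] (p : ℕ) [Fact p.Prime] [CharP K p]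

/-- The empty family is `p`-independent. [folklore] -/
theorem pIndep_empty : ∀ (s : ℕ) (b : Fin s → K), Function.Injective b → (∀ i, b i ∈ (∅ : Set K)) →
    LinearIndependent (frobenius K p).range (fun n : Fin s → Fin p => ∏ i, b i ^ (n i : ℕ)) := by
  intro s b _ hmem
  rcases Nat.eq_zero_or_pos s with rfl | hs
  · rw [Fintype.linearIndependent_iff]
    intro g hg n
    rw [Finset.sum_eq_single n (fun n' _ hn' => absurd (Subsingleton.elim n' n) hn')
      (fun h => absurd (Finset.mem_univ n) h)] at hg
    simp only [Finset.univ_eq_empty, Finset.prod_empty, Subring.smul_def, smul_eq_mul,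
      mul_one] at hg
    exact Subtype.ext hg
  · exact absurd (hmem ⟨0, hs⟩) (Set.notMem_empty _)

/-- A `p`-independent generating set is a `p`-basis over `K^p` (`IsPBasisOver`). [folklore] -/
theorem isPBasisOver_of_pIndep_of_univ_subset {Γ : Set K}
    (hind : ∀ (s : ℕ) (b : Fin s → K), Function.Injective b → (∀ i, b i ∈ Γ) →
      LinearIndependent (frobenius K p).range (fun n : Fin s → Fin p => ∏ i, b i ^ (n i : ℕ)))
    (hgen : Set.univ ⊆ (Subring.closure (Set.range (frobenius K p) ∪ Γ) : Set K)) :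
    IsPBasisOver p (frobenius K p).range Γ := by
  refine ⟨?_, hind⟩
  rw [eq_top_iff]
  intro x _
  rw [Algebra.mem_adjoin_iff]
  have hr : Set.range (algebraMap (frobenius K p).range K) = Set.range (frobenius K p) := by
    ext z
    constructor
    · rintro ⟨⟨w, y, hy⟩, rfl⟩
      exact ⟨y, hy⟩
    · rintro ⟨y, rfl⟩
      exact ⟨⟨frobenius K p y, y, rfl⟩, rfl⟩
  rw [hr]
  exact hgen (Set.mem_univ x)

/-- A derivation killing `B` kills `K^p[B] = Subring.closure (K^p ∪ B)`. [folklore] -/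
theorem derivation_eq_zero_of_mem_closure (D : Derivation ℤ K K) {B : Set K} (hB : ∀ b ∈ B, D b = 0)
    {x : K} (hx : x ∈ Subring.closure (Set.range (frobenius K p) ∪ B)) : D x = 0 := by
  induction hx using Subring.closure_induction with
  | mem y hy =>
    rcases hy with ⟨w, rfl⟩ | hy
    · rw [frobenius_def]
      exact derivation_pow_char D w
    · exact hB y hy
  | zero => exact map_zero D
  | one => exact D.map_one_eq_zero
  | add a b _ _ ha hb => rw [map_add, ha, hb, add_zero]
  | neg a _ ha => rw [map_neg, ha, neg_zero]
  | mul a b _ _ ha hb => rw [D.leibniz, ha, hb, smul_zero, smul_zero, add_zero]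

end Tools

/-! ## LEMMA F₀ (pure field theory, Mathlib only) -/

namespace LemmaF0

variable {K : Type} [Field K]

/-- The range of `algebraMap F K` for a subfield `F` is `F`. [folklore] -/
theorem range_algebraMap_subfield (F : Subfield K) : Set.range (algebraMap F K) = (F : Set K) := by
  ext z
  constructor
  · rintro ⟨c, rfl⟩
    exact c.2
  · intro hz
    exact ⟨⟨z, hz⟩, rfl⟩

/-- Membership in `F(x₀)`: subfield closure versus `IntermediateField.adjoin`. [folklore] -/
theorem mem_closure_iff_mem_adjoin (F : Subfield K) (x₀ z : K) :
    z ∈ Subfield.closure ((F : Set K) ∪ {x₀}) ↔ z ∈ IntermediateField.adjoin F ({x₀} : Set K) := by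
  rw [← IntermediateField.mem_toSubfield, IntermediateField.adjoin_toSubfield, range_algebraMap_subfield]

/-- (i) If `x₀` is algebraic over `F`, then `F(x₀)` is contained in a finite `F`-span. [folklore] -/
theorem exists_span_of_isAlgebraic (F : Subfield K) {x₀ : K} (hx : IsAlgebraic F x₀) :
    ∃ (d : ℕ) (ρ : Fin d → K), ∀ z ∈ Subfield.closure ((F : Set K) ∪ {x₀}),
      ∃ b : Fin d → K, (∀ i, b i ∈ F) ∧ z = ∑ i, b i * ρ i := by
  have hint : IsIntegral F x₀ := isAlgebraic_iff_isIntegral.mp hx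
  let pb := IntermediateField.adjoin.powerBasis hint
  refine ⟨pb.dim, fun i => (pb.basis i : K), fun z hz => ?_⟩
  rw [mem_closure_iff_mem_adjoin] at hz
  refine ⟨fun i => (pb.basis.repr ⟨z, hz⟩ i : K), fun i => Subtype.coe_prop _, ?_⟩
  have key := congrArg (fun y : IntermediateField.adjoin F ({x₀} : Set K) => (y : K))
    (pb.basis.sum_repr ⟨z, hz⟩)
  simp only at key
  calc z = _ := key.symm
    _ = _ := by
      rw [IntermediateField.coe_sum]
      refine Finset.sum_congr rfl fun i _ => ?_
      rw [IntermediateField.coe_smul, Algebra.smul_def]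
      rfl

/-- (ii) If `x₀` is transcendental over `F`, `F ≤ M` with `M^p ⊆ F`, then an `F`-linearly independent family of elements
of `M` stays `F(x₀)`-linearly independent. [folklore] -/
theorem linearIndependent_adjoin_of_transcendental {p : ℕ} [Fact p.Prime] [CharP K p]
    (F M : Subfield K) (hFM : F ≤ M) (hMp : ∀ y ∈ M, y ^ p ∈ F) {x₀ : K} (hx : Transcendental F x₀)
    {ι : Type} [Fintype ι] {ν : ι → K} (hνM : ∀ i, ν i ∈ M) (hind : LinearIndependent F ν) :
    LinearIndependent (Subfield.closure ((F : Set K) ∪ {x₀})) ν := by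
  classical
  have hp : p.Prime := Fact.out
  set F' := Subfield.closure ((F : Set K) ∪ {x₀}) with hF'
  rw [Fintype.linearIndependent_iff] at hind ⊢
  intro c hc
  have hc' : ∑ i, ((c i : F') : K) * ν i = 0 := by
    simp_rw [Algebra.smul_def] at hc
    exact hc
  -- each `c i = P/Q` with `Q(x₀) ≠ 0`
  have hPQ : ∀ i, ∃ P Q : (F)[X], aeval x₀ Q ≠ 0 ∧ ((c i : F') : K) = aeval x₀ P / aeval x₀ Q := by
    intro i
    obtain ⟨P, Q, h⟩ := (IntermediateField.mem_adjoin_simple_iff (F := F) (α := x₀) ((c i : F') : K)).mp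
      ((mem_closure_iff_mem_adjoin F x₀ _).mp (c i).2)
    by_cases hQ : aeval x₀ Q = 0
    · refine ⟨0, 1, by simp, ?_⟩
      rw [h, hQ, div_zero, map_zero, map_one, zero_div]
    · exact ⟨P, Q, hQ, h⟩
  choose P Q hQ hcPQ using hPQ
  -- clear denominators: `R i := P i * ∏_{i' ≠ i} Q i'`, `aeval x₀ (R i) = c i * D`
  set R : ι → (F)[X] := fun i => P i * ∏ i' ∈ Finset.univ.erase i, Q i' with hR
  have hRc : ∀ i, aeval x₀ (R i) = ((c i : F') : K) * ∏ i', aeval x₀ (Q i') := by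
    intro i
    simp only [hR, map_mul, map_prod]
    rw [hcPQ i, ← Finset.mul_prod_erase Finset.univ (fun i' => aeval x₀ (Q i')) (Finset.mem_univ i),
      div_mul_eq_mul_div, mul_left_comm, mul_div_cancel_left₀ _ (hQ i)]
  have hrel : ∑ i, aeval x₀ (R i) * ν i = 0 := by
    simp_rw [hRc, mul_right_comm _ _ (ν _)]
    rw [← Finset.sum_mul, hc', zero_mul]
  -- expand in powers of `x₀`
  set N := Finset.univ.sup (fun i => (R i).natDegree) + 1 with hN
  have hdeg : ∀ i, (R i).natDegree < N := fun i =>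
    Nat.lt_succ_of_le (Finset.le_sup (f := fun i => (R i).natDegree) (Finset.mem_univ i))
  have hexp : ∀ i, aeval x₀ (R i) = ∑ d ∈ Finset.range N, (((R i).coeff d : F) : K) * x₀ ^ d := by
    intro i
    rw [aeval_eq_sum_range' (hdeg i)]
    refine Finset.sum_congr rfl fun d _ => ?_
    rw [Algebra.smul_def]
    rfl
  set m : ℕ → K := fun d => ∑ i, (((R i).coeff d : F) : K) * ν i with hm
  have hmM : ∀ d, m d ∈ M := fun d =>
    sum_mem fun i _ => mul_mem (hFM ((R i).coeff d).2) (hνM i)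
  have hsum : ∑ d ∈ Finset.range N, m d * x₀ ^ d = 0 := by
    rw [← hrel]
    simp_rw [hexp, hm, Finset.sum_mul]
    rw [Finset.sum_comm]
    refine Finset.sum_congr rfl fun i _ => Finset.sum_congr rfl fun d _ => ?_
    ring
  -- Frobenius
  have hsum' : ∑ d ∈ Finset.range N, (m d) ^ p * (x₀ ^ p) ^ d = 0 := by
    have h := congrArg (frobenius K p) hsum
    rw [map_sum, map_zero] at h
    rw [← h]
    refine Finset.sum_congr rfl fun d _ => ?_
    rw [frobenius_def, mul_pow, ← pow_mul, ← pow_mul, mul_comm p d]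
  have hmF : ∀ d, (m d) ^ p ∈ F := fun d => hMp _ (hmM d)
  set Φ : (F)[X] := ∑ d ∈ Finset.range N, C (⟨(m d) ^ p, hmF d⟩ : F) * X ^ d with hΦ
  have hΦeval : aeval (x₀ ^ p) Φ = 0 := by
    rw [hΦ, map_sum, ← hsum']
    refine Finset.sum_congr rfl fun d _ => ?_
    rw [map_mul, map_pow, aeval_C, aeval_X]
    rfl
  have hxp : Transcendental F (x₀ ^ p) := hx.pow hp.pos
  have hΦ0 : Φ = 0 := (transcendental_iff_injective.mp hxp) (by rw [hΦeval, map_zero])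
  have hmd : ∀ d ∈ Finset.range N, m d = 0 := by
    intro d hd
    have hcoef : Φ.coeff d = ⟨(m d) ^ p, hmF d⟩ := by
      rw [hΦ, finsetSum_coeff]
      simp_rw [coeff_C_mul_X_pow]
      rw [Finset.sum_ite_eq, if_pos hd]
    rw [hΦ0, coeff_zero] at hcoef
    have h0 : (m d) ^ p = 0 := by
      have := congrArg Subtype.val hcoef
      simpa using this.symm
    exact (pow_eq_zero_iff hp.ne_zero).mp h0
  -- all coefficients of `R i` vanish
  have hcoeff : ∀ i d, (R i).coeff d = 0 := by
    intro i d
    by_cases hd : d < N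
    · have h0 : ∑ i, (((R i).coeff d : F) : K) * ν i = 0 := hmd d (Finset.mem_range.mpr hd)
      refine hind (fun i => (R i).coeff d) ?_ i
      simp_rw [Algebra.smul_def]
      exact h0
    · exact coeff_eq_zero_of_natDegree_lt (lt_of_lt_of_le (hdeg i) (not_lt.mp hd))
  have hR0 : ∀ i, R i = 0 := fun i => Polynomial.ext fun d => by rw [hcoeff, coeff_zero]
  have hQ0 : ∀ i, Q i ≠ 0 := fun i h => hQ i (by rw [h, map_zero])
  have hP0 : ∀ i, P i = 0 := by
    intro i
    have h := hR0 i
    simp only [hR] at h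
    exact (mul_eq_zero.mp h).resolve_right (Finset.prod_ne_zero_iff.mpr fun i' _ => hQ0 i')
  intro i
  apply Subtype.ext
  rw [hcPQ i, hP0, map_zero, zero_div]
  rfl

/-- LEMMA F₀, general-index form, by induction on the generators. -/
theorem finite_span_aux {p : ℕ} [Fact p.Prime] [CharP K p] (w : Finset K) :
    ∀ (F M : Subfield K), F ≤ M → (∀ x ∈ M, x ^ p ∈ F) →
      (M : Set K) ⊆ (Subfield.closure ((F : Set K) ∪ ↑w) : Set K) →
      ∃ (ι : Type) (_ : Fintype ι) (μ : ι → K), ∀ x ∈ M, ∃ a : ι → K, (∀ i, a i ∈ F) ∧ x = ∑ i, a i * μ i := by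
  classical
  induction w using Finset.induction_on with
  | empty =>
    intro F M hFM hMp hMw
    refine ⟨Unit, inferInstance, fun _ => 1, fun x hx => ⟨fun _ => x, fun _ => ?_, by simp⟩⟩
    have : x ∈ Subfield.closure ((F : Set K) ∪ ↑(∅ : Finset K)) := hMw hx
    rwa [Finset.coe_empty, Set.union_empty, Subfield.closure_eq] at this
  | insert x₀ w _ ih =>
    intro F M hFM hMp hMw
    set F' : Subfield K := Subfield.closure ((F : Set K) ∪ {x₀}) with hF'def
    have hFF' : F ≤ F' := fun z hz => Subfield.subset_closure (Or.inl hz)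
    have hx₀F' : x₀ ∈ F' := Subfield.subset_closure (Or.inr rfl)
    set M' : Subfield K := M ⊔ F' with hM'def
    have hF'M' : F' ≤ M' := le_sup_right
    have hMM' : M ≤ M' := le_sup_left
    have hM'p : ∀ y ∈ M', y ^ p ∈ F' := by
      have hle : M' ≤ F'.comap (frobenius K p) := by
        refine sup_le (fun y hy => ?_) (fun y hy => ?_)
        · rw [Subfield.mem_comap, frobenius_def]
          exact hFF' (hMp y hy)
        · rw [Subfield.mem_comap, frobenius_def]
          exact pow_mem hy p
      intro y hy
      have := hle hy
      rwa [Subfield.mem_comap, frobenius_def] at this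
    have hM'w : (M' : Set K) ⊆ (Subfield.closure ((F' : Set K) ∪ ↑w) : Set K) := by
      have hle : M' ≤ Subfield.closure ((F' : Set K) ∪ ↑w) := by
        refine sup_le (fun y hy => ?_) (fun y hy => Subfield.subset_closure (Or.inl hy))
        refine Subfield.closure_mono ?_ (hMw hy)
        rintro z (hz | hz)
        · exact Or.inl (hFF' hz)
        · rw [Finset.coe_insert, Set.mem_insert_iff] at hz
          rcases hz with rfl | hz
          · exact Or.inl hx₀F'
          · exact Or.inr hz
      exact hle
    obtain ⟨ι, _, μ, hμ⟩ := ih F' M' hF'M' hM'p hM'w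
    by_cases halg : IsAlgebraic F x₀
    · -- algebraic generator: compose the two finite spans
      obtain ⟨d, ρ, hρ⟩ := exists_span_of_isAlgebraic F halg
      refine ⟨ι × Fin d, inferInstance, fun ji => ρ ji.2 * μ ji.1, fun x hx => ?_⟩
      obtain ⟨a, haF', hxa⟩ := hμ x (hMM' hx)
      choose b hbF hab using fun j => hρ (a j) (haF' j)
      refine ⟨fun ji => b ji.1 ji.2, fun ji => hbF _ _, ?_⟩
      rw [hxa, Fintype.sum_prod_type]
      refine Finset.sum_congr rfl fun j _ => ?_
      rw [hab j, Finset.sum_mul]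
      refine Finset.sum_congr rfl fun i _ => ?_
      ring
    · -- transcendental generator: rank argument
      have htr : Transcendental F x₀ := halg
      let MF : Submodule F K :=
        { carrier := M
          add_mem' := fun ha hb => M.add_mem ha hb
          zero_mem' := M.zero_mem
          smul_mem' := fun c x hx => by
            rw [Algebra.smul_def]
            exact M.mul_mem (hFM c.2) hx }
      haveI : Module.Finite F' (Submodule.span F' (Set.range μ)) :=
        Module.Finite.span_of_finite _ (Set.finite_range μ)
      have hbound : ∀ s : Finset MF, (LinearIndependent F fun i : s => (i : MF)) →
          s.card ≤ Fintype.card ι := by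
        intro s hli
        let ν : s → K := fun i => ((i : MF) : K)
        have hνM : ∀ i, ν i ∈ M := fun i => (i : MF).2
        have hν : LinearIndependent F ν := hli.map' MF.subtype (Submodule.ker_subtype MF)
        have hν' := linearIndependent_adjoin_of_transcendental F M hFM hMp htr hνM hν
        have hνW : ∀ i, ν i ∈ Submodule.span F' (Set.range μ) := by
          intro i
          obtain ⟨a, haF', h⟩ := hμ (ν i) (hMM' (hνM i))
          rw [h]
          refine Submodule.sum_mem _ fun j _ => ?_
          have h1 : a j * μ j = (⟨a j, haF' j⟩ : F') • μ j := by
            rw [Algebra.smul_def]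
            rfl
          rw [h1]
          exact Submodule.smul_mem _ _ (Submodule.subset_span (Set.mem_range_self j))
        let ν' : s → Submodule.span F' (Set.range μ) := fun i => ⟨ν i, hνW i⟩
        have hν'ind : LinearIndependent F' ν' :=
          LinearIndependent.of_comp (Submodule.span F' (Set.range μ)).subtype hν'
        have h1 := hν'ind.fintype_card_le_finrank
        have h2 := finrank_range_le_card (R := F') μ
        rw [Fintype.card_coe] at h1
        exact h1.trans h2
      have hrank : Module.rank F MF ≤ Fintype.card ι := rank_le hbound
      haveI : Module.Free F MF := Module.Free.of_divisionRing F MF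
      haveI : Module.Finite F MF := by
        rw [← Module.rank_lt_aleph0_iff]
        exact lt_of_le_of_lt hrank (Cardinal.natCast_lt_aleph0 (n := Fintype.card ι))
      obtain ⟨n, s, hs⟩ := Module.Finite.exists_fin (R := F) (M := MF)
      refine ⟨Fin n, inferInstance, fun i => (s i : K), fun x hx => ?_⟩
      have hxs : (⟨x, hx⟩ : MF) ∈ Submodule.span F (Set.range s) := by
        rw [hs]
        exact Submodule.mem_top
      rw [Submodule.mem_span_range_iff_exists_fun] at hxs
      obtain ⟨c, hc⟩ := hxs
      refine ⟨fun i => (c i : K), fun i => (c i).2, ?_⟩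
      have h := congrArg (fun y : MF => (y : K)) hc
      simp only at h
      rw [← h, Submodule.coe_sum]
      refine Finset.sum_congr rfl fun i _ => ?_
      rw [Submodule.coe_smul, Algebra.smul_def]
      rfl

/-- **LEMMA F₀.** [folklore] -/
theorem heightOneIntermediateFinite (p : ℕ) (hp : p.Prime) :
    ∀ (K : Type) [Field K] [CharP K p] (F M : Subfield K) (w : Finset K),
      F ≤ M → (∀ x ∈ M, x ^ p ∈ F) → (M : Set K) ⊆ (Subfield.closure ((F : Set K) ∪ ↑w) : Set K) →
      ∃ (f : ℕ) (μ : Fin f → K), ∀ x ∈ M, ∃ a : Fin f → K, (∀ j, a j ∈ F) ∧ x = ∑ j, a j * μ j := by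
  intro K _ _ F M w hFM hMp hMw
  haveI : Fact p.Prime := ⟨hp⟩
  classical
  obtain ⟨ι, _, μ, hμ⟩ := finite_span_aux w F M hFM hMp hMw
  refine ⟨Fintype.card ι, fun j => μ ((Fintype.equivFin ι).symm j), fun x hx => ?_⟩
  obtain ⟨a, haF, hxa⟩ := hμ x hx
  refine ⟨fun j => a ((Fintype.equivFin ι).symm j), fun j => haF _, ?_⟩
  rw [hxa]
  exact (Equiv.sum_comp (Fintype.equivFin ι).symm (fun i => a i * μ i)).symm

end LemmaF0

end Summit.ResolutionOfSingularities.ResolutionOfSingularities.Theorems.RadicialJung.CleanModels.Lens5.AbsDerivation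

end
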